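import Summits.HodgeConjecture.HodgeConjecture.Theorems.H413SpectrumInterfaces
import Summits.HodgeConjecture.HodgeConjecture.Theorems.A3Liu413StubG2Holds
import HarnessLib

/-!
# FLOOR-0 P2 — stub U4 `stub_U4_signRule` FOLDED onto ONE engine socket E3 «occurrence ⇒ parity»: `StubU4SignRule ⇐ StubE3OccurrenceParityAt`
# through the ★ arithmetic half `Liu2021.isAdmissible_epsOf_iff_even` (Def. 4.12 ⟺ parity)

Cell hodgecm-mathlib (D-0151), FLOOR 0, crux item H413 = stmt-HodgeConjecture-24833; programme P2, line of record
`Cruxes/H413/Lines/P2ThetaDictionaryExists.lean` (A-p18 (g15) v3 8c6e58a8), registered stub **U4 `stub_U4_signRule : StubU4SignRule`** (:399 ∕ :418; TYPE = ★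
`SpectrumInterfaces.StubU4SignRule`).  PLAN-P2 v1.2 §6.3 (F0P2-plan (g0), 2026-08-30T22:42Z): **U4 = E3 ∧ G4 with kernel-trivial glue**, G4 = ★
`Liu2021.isAdmissible_epsOf_iff_even` (Hasse ∕ CFT half, O'Meara 71:18–19, PROVED in the tree), E3 = the ONE engine socket «an occurring genuine weight-one `ω_V(μ, ε, χ)` has
EVEN parity `#{v : ε_v ≠ 1} + #{φ ∈ Φ_μ : Im φ(δ′) > 0}`» ([Rogawski1992, Thm. 1.1] = [GelbartRogawski1991, §3 (3.3)–(3.5) pp. 446–447], [Rogawski1990, §12.3, §13.3, §14.6],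
local dichotomy [HarrisKudlaSweet1996, Thm. 6.1]; [Liu2021, Rem. 4.14]).  Author F0P2-p04 (g0) (wave 2; U1′ closed ★ p792926, this is the seat's second share, bus
`F0/P2/STATUS.md` 22:5xZ TAKING).  `--supports stmt-HodgeConjecture-24833 --as helper`.  HC_CM is proved only modulo the 7 printed citations until rung 0 closes; this
file proves nothing about them — it REDUCES U4 to the socket E3 in the kernel.

CONTENTS.  The arithmetic half AT THE PIN is already ★: `A3Liu413.isAdmissible_datum413_iff_even` (`Theorems/A3Liu413StubG2Holds.lean`, fan B-III (T4) closer of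
`stub_G2`): for every triple `t` of `datum413 …`, `t.IsAdmissible ↔ ({v | t.ε v ≠ 1}.Finite ∧ Even (#{v | t.ε v ≠ 1} + #{φ ∈ Φ_μ | 0 < Im φ(δ′)}))` with `δ′ = (2·δ_L)⁻¹` the
pin's ε-normaliser (`(datum413 …).epsOf = Def411WeilCarriers.epsOf L⁺ (imagUnitSq L) L δ′` definitionally).  This file adds only:
* the SOCKET `StubE3OccurrenceParityAt` (U4's telescope VERBATIM ⇒ that parity clause VERBATIM; a hypothesis TYPE of the reduction, no citation tag by design — s355), and
* **`stubU4_of_parity (hE3 : StubE3OccurrenceParityAt) : SpectrumInterfaces.StubU4SignRule`** (`.mpr` of the ★ iff, binder for binder).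
The registrar's parent-line edition: register `stub_E3_occurrenceParityAt : StubE3OccurrenceParityAt` (sorry) and fold
`theorem stub_U4_signRule : StubU4SignRule := P2StubU4OfParity.stubU4_of_parity stub_E3_occurrenceParityAt`.

JUNK AUDIT (PLAN §6.3): at a non-occurring `t` the socket is vacuous; `IsGlobalEps` keeps `ε` in the image of `epsOf`, so the finiteness clause is automatic in the engine's
proof and the parity is well defined (changing the global `e` by `θ ∈ F^×` flips an even number of signs — the `.mp` direction of the ★ iff); the parity does not depend on `τ'`.

## References
* [Liu2021] Y. Liu, Camb. J. Math. 9 (2021) = arXiv:2102.11518, Def. 4.12 (l. 2102–2108), Prop. 4.13, Rem. 4.14.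
* [Rogawski1992] J. Rogawski, *The multiplicity formula for A-packets*, in: The zeta functions of Picard modular surfaces (1992), Thm. 1.1.
* [GelbartRogawski1991] S. Gelbart, J. Rogawski, Invent. Math. 105 (1991), §3 (3.3)–(3.5) pp. 446–447, Thm. 5.1.1.
* [Rogawski1990] J. Rogawski, Ann. of Math. Stud. 123, §12.3, Thm. 13.3.7, Thm. 14.6.4.  [HarrisKudlaSweet1996] J. AMS 9, Thm. 6.1.  [Omeara1963] §71, 71:18–71:19.
* Tree: ★ `Theorems/H413SpectrumInterfaces` (`StubU4SignRule`, `OccurringGlobalThetaIsAdmissible`, `IsGlobalEps`), ★ `Theorems/A3Liu413StubG2Holds`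
  (`A3Liu413.isAdmissible_datum413_iff_even`, over ★ `Liu2021/Def412AdmissibleIffParity.isAdmissible_epsOf_iff_even`), ★ `Liu2021/Prop413AsPrinted` (`Triple.IsAdmissible`,
  `Triple.cmType`), `CorCM/Hyp413/A3Liu413FaceTypes` (`datum413`).
-/

set_option autoImplicit false
set_option linter.dupNamespace false

noncomputable section

namespace Summit.HodgeConjecture.HodgeConjecture.Cruxes.H413.P2StubU4OfParity

open scoped TensorProduct Matrix
open NumberField NumberField.InfinitePlace IsDedekindDomain
open HodgeCM.Model HodgeCM.Model.LiuIndex HodgeCM.Model.TowerCarrier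
open Summit.HodgeConjecture.CorCM.Model
open Literature.AlgebraicGeometry.Motives (CMType AbelianVariety)
open Literature.AlgebraicGeometry.Liu2021 (IsAdmissibleElement)
open Literature.AlgebraicGeometry.HodgeTheory Literature.NumberTheory.Automorphic.PicardCM
open Literature.AlgebraicGeometry.ShimuraVarieties Literature.AlgebraicGeometry.ShimuraVarieties.UnitaryCanonicalModel
open Literature.NumberTheory.ComplexMultiplication
open Literature.NumberTheory.Automorphic
open Literature.NumberTheory.Automorphic.Liu2021 Literature.NumberTheory.Automorphic.Liu2021.AppendixC
open Literature.NumberTheory.Automorphic.Liu2021.Def411WeilCarriers (lineOf locF Rep)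
open Summit.HodgeConjecture.CorCM.Transposition.OmegaTransport (realUnit)
open HodgeCM.Model.ArchSideTerm (e₁)
open Literature.NumberTheory.GelbartRogawski1991 Literature.NumberTheory.GelbartRogawski1991.UnitaryDualPair
open Literature.RepresentationTheory Literature.RepresentationTheory.Liu2021
open Summit.HodgeConjecture.CorCM
open Summit.HodgeConjecture.CorCM.Transposition
open Literature.NumberTheory.GelbartRogawski1991.OscillatorTripleDictionary (OccursInH1 IsIsoToOmega rhoTriple)
open Summit.HodgeConjecture.CorCM.Lines.A3Liu418 (Thm415AtFace EpsRigidAtFace)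
open Summit.HodgeConjecture.HodgeConjecture.Theses (HCCMUnconditional.HDel)
open MulAction
open Literature.Geometry.ComplexHyperbolic.BallModel (U21 x₀)
open Summit.HodgeConjecture.CorCM.Lines.A3Liu413 (datum413)
open Summit.HodgeConjecture.HodgeConjecture.Cruxes.H413.CohFormsCarriers
open Summit.HodgeConjecture.HodgeConjecture.Cruxes.H413.SpectrumInterfaces

/-! ## The socket E3 and the fold -/

set_option synthInstance.maxHeartbeats 400000 in
set_option maxHeartbeats 8000000 in
/-- **SOCKET E3 — «OCCURRENCE ⇒ PARITY» at the printed datum of every face** (the ONE engine input of U4; a hypothesis TYPE of this reduction, not a vendored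
statement): at `n = 3`, for every `τ'` and every adèlic oscillator triple `t = (μ, ε, χ)` with `μ` of weight one and `ε` GLOBAL, if `ω_V(t)` occurs in the pin's
`H¹_{B,τ'}(A_∞, ℂ)` then `ε_v ≠ 1` for finitely many `v` and `#{v : ε_v ≠ 1} + #{φ ∈ Φ_μ : Im φ(δ′) > 0}` is EVEN (`δ′ = (2 δ_L)⁻¹` the pin's ε-normaliser).  Reading:
Rogawski's multiplicity formula for the endoscopic packets `Π(ρ)`, `dim ρ = 1` (Rogawski 1992, Thm. 1.1, correcting the 1990 book's Thm. 13.3.7; Gelbart–Rogawski 1991,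
§3 (3.3)–(3.5)) read on oscillator data through the local theta dichotomy (Harris–Kudla–Sweet 1996, Thm. 6.1) and the archimedean members `J^±` (Rogawski 1990, §12.3);
Liu 2021, Rem. 4.14.  The telescope is U4's (`SpectrumInterfaces.OccurringGlobalThetaIsAdmissible`) VERBATIM and the conclusion is the right-hand side of ★
`A3Liu413.isAdmissible_datum413_iff_even` (= ★ `Liu2021.isAdmissible_epsOf_iff_even` at the pin) VERBATIM, so that the fold `stubU4_of_parity` is `.mpr`. -/
def StubE3OccurrenceParityAt : Prop :=
  ∀ (hDel : Literature.AlgebraicGeometry.ShimuraVarieties.UnitaryCanonicalModel.canonicalModel_exists_printed)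
    (F : HodgeCM.CMField) [IsGalois ℚ F] (h6 : 6 ≤ Module.finrank ℚ F) {ι₁ : F →+* ℂ} (V : HodgeCM.HermSpace3 F ι₁) (a₀ : RealScalar F)
    (Φ : CMType F) (hΦ : ι₁ ∈ Φ.1) (i : (I V (repAt a₀) (muLiu ι₁ GramClass.rep))),
    (datum413 hDel F V a₀ Φ i).n = 3 →
      ∀ (τ' : HodgeCM.CMField.K F →+* ℂ) (t : (datum413 hDel F V a₀ Φ i).Triple), t.HasWeightOne →
        IsGlobalEps (datum413 hDel F V a₀ Φ i) t.ε → OccursInH1 (datum413 hDel F V a₀ Φ i) τ' (rhoTriple (datum413 hDel F V a₀ Φ i) t) →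
          ({v : HeightOneSpectrum (𝓞 ↥(maximalRealSubfield (HodgeCM.CMField.K F))) | t.ε v ≠ 1}.Finite ∧
            Even ({v : HeightOneSpectrum (𝓞 ↥(maximalRealSubfield (HodgeCM.CMField.K F))) | t.ε v ≠ 1}.ncard +
              {φ : HodgeCM.CMField.K F →+* ℂ | φ ∈ t.cmType.1 ∧ 0 < (φ (2 * imagUnit (HodgeCM.CMField.K F))⁻¹).im}.ncard))

set_option synthInstance.maxHeartbeats 400000 in
set_option maxHeartbeats 8000000 in
/-- **U4 FROM E3 — the sign rule at the pin is the engine's parity statement read through [Liu2021, Def. 4.12] ⟺ parity**: `StubU4SignRule` (a genuine weight-one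
`ω_V(μ, ε, χ)` with global `ε` occurring in `H¹_{B,τ'}` has `ε` `μ`-admissible) follows from `StubE3OccurrenceParityAt` by ★ `A3Liu413.isAdmissible_datum413_iff_even` (`.mpr`), binder for
binder.  The registrar's fold: `theorem stub_U4_signRule : StubU4SignRule := P2StubU4OfParity.stubU4_of_parity stub_E3_occurrenceParityAt`.
[cite: Liu2021, Def. 4.12, Prop. 4.13 (proof l. 2145), Rem. 4.14] [cite: GelbartRogawski1991, Introduction p. 446 L9–11; Thm 5.1.1 p. 465] [cite: Rogawski1992, Thm. 1.1]
[cite: Omeara1963, §71 Thm. 71:19] -/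
theorem stubU4_of_parity (hE3 : StubE3OccurrenceParityAt) : StubU4SignRule :=
  fun hDel F _ h6 _ V a₀ Φ hΦ i hn τ' t hw hε hocc =>
    (Summit.HodgeConjecture.CorCM.Lines.A3Liu413.isAdmissible_datum413_iff_even hDel F V a₀ Φ i t).mpr
      (hE3 hDel F h6 V a₀ Φ hΦ i hn τ' t hw hε hocc)

end Summit.HodgeConjecture.HodgeConjecture.Cruxes.H413.P2StubU4OfParity

end
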